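import Literature.NumberTheory.Automorphic.UnitaryGroupBorelHeight
import HarnessLib

/-!
# The Borel constant term and the rank-one truncation `Λ^T` on the quasi-split unitary group
# `U(J_N)` (letters for the trace formula of the quasi-split group, III b)

Topic `NumberTheory/Automorphic`; namespace `Literature.NumberTheory.Automorphic.UnitaryGroup`.
DEFINITIONS with bodies + proved structure lemmas; no named fact, no `sorry`, no instance, no
notation. Setting: Mok's `U_{E/F}(N) = U(J_N)` (`UnitaryGroup.quasiSplit F E c N`), its standard
Borel pair `B(𝔸_F) = N(𝔸_F) · T(𝔸_F)` (`borelAdelic`, `adelicUnipotent`, `torusAdelic`),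
`G(F) = arithmeticSubgroup` diagonally embedded, and the Borel height `borelHeight` of
`UnitaryGroupBorelHeight`.

* §1 `borelConstantTerm ν 𝓕 φ g = ν(𝓕)⁻¹ ∫_𝓕 φ(u g) dν(u)` — the constant term of `φ` ALONG THE BOREL
  SUBGROUP, the integral being over a fundamental domain `𝓕` of `N(F)` in the FULL unipotent
  radical `N(𝔸_F) = adelicUnipotent F E c N` (upper unitriangular elements of `U(J_N)(𝔸_F)`);
  for `N = 3` this is Rogawski's `φ_N` / Arthur's `φ_P`, `P = B` (Rogawski (1990), §2.1:
  `φ_P(g) = ∫_{N_P \ 𝐍_P} φ(ng) dn`; Mœglin–Waldspurger (1995), I.2.6). `BorelCuspCondition φ` —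
  vanishing of all Borel constant terms (for `F`-rank one, i.e. `N = 2, 3`, where `B` is the only
  proper standard parabolic, this IS cuspidality).
  CAVEAT (recorded; kernel-checked in the report file accompanying this letter): the tree's
  `UnitaryGroup.unipotentRadical F E c N k = U(J_N)(𝔸_F) ∩ (1 + 𝔫_k)` is, for `2k < N`, only the
  CENTRE of the unipotent radical of the maximal parabolic `P_k` (unitarity pairs the two
  off-diagonal blocks of the genuine radical, and `𝔫_k` kills one of them); so the tree's
  `CuspCondition φ k` / `constantTerm k` (letter II) integrate over that centre — for `U(3)`,
  `k = 1`, over `Z(N) = {u(0, z)}`, not over `N = {u(x, z)}`. The objects of this file use the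
  genuine `N(𝔸_F)`.
* §2 `pseudoEisenstein ψ g = Σ_{δ ∈ B(F)\G(F)} ψ(δ g)` (Garrett's `Ψ_ψ`: a `finsum` over the right
  cosets of `B(F) = arithmeticBorel` in `G(F)`, representatives by `Quotient.out`; independent of
  the representatives for left-`B(F)`-invariant `ψ`, `pseudoEisenstein_term_eq`), the **tail of the
  constant term** `constantTermTail ν 𝓕 T φ = 1_{borelHeight > T} · φ_B`, and **Arthur's truncation in
  `F`-rank one** `truncation ν 𝓕 T φ = φ − Ψ(constantTermTail ν 𝓕 T φ)` (Garrett (2018), §2.10: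
  `Λ^T f = f − Ψ(c_P^T f)`; Arthur, Compositio Math. 40 (1980), §1; for `N ≥ 4` this is only the
  Borel term of Arthur's alternating sum over standard parabolics — recorded, not asserted);
  `BorelCuspCondition.truncation_eq`: `Λ^T φ = φ` on Borel-cuspidal `φ`.

Not here (letter IV): the kernels `K_B(x, y) = Σ_{γ ∈ T(F)} ∫_{N(𝔸_F)} f(x⁻¹ γ n y) dn`, the modified
kernel `k^T(x)` and `J^T(f) = ∫_{G(F)\G(𝔸_F)} k^T(x) dx` of Rogawski (1990), §2.2.

## References

* J. D. Rogawski, *Automorphic Representations of Unitary Groups in Three Variables* (1990),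
  §2.1–§2.2 [Rogawski1990].
* P. Garrett, *Modern Analysis of Automorphic Forms by Example* (2018), §2.10 [Garrett2018].
* C. Mœglin, J.-L. Waldspurger, *Spectral decomposition and Eisenstein series* (1995), I.2.6
  [MoeglinWaldspurger1995].
-/

noncomputable section

open MeasureTheory NumberField IsDedekindDomain Matrix
open scoped MatrixGroups NNReal

namespace Literature.NumberTheory.Automorphic

namespace UnitaryGroup

variable {F E : Type} [Field F] [NumberField F] [Field E] [NumberField E] [Algebra F E]
  {c : E ≃ₐ[F] E} {N : ℕ}

/-! ## §1 The constant term along the Borel subgroup -/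

section ConstantTerm

variable [MeasurableSpace (adelicUnipotent F E c N)]

/-- **The constant term of `φ : U_{E/F}(N)(𝔸_F) → ℂ` along the Borel subgroup**, realised with a
Haar measure `ν` of the full unipotent radical `N(𝔸_F) = adelicUnipotent F E c N` and a fundamental
domain `𝓕` of `N(F)`: `φ_B(g) = ν(𝓕)⁻¹ ∫_𝓕 φ(u g) dν(u)` (`= ∫_{N(F)\N(𝔸_F)} φ(ng) dn` for the
probability Haar measure of the compact quotient; Rogawski (1990), §2.1 `φ_P(g) = ∫_{N_P\𝐍_P} φ(ng) dn`
with `P = B`; Mœglin–Waldspurger (1995), I.2.6). Degenerate data (`ν 𝓕 ∈ {0, ∞}`) give the junk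
value `0`. [cite: Rogawski1990, §2.1] -/
def borelConstantTerm (ν : Measure (adelicUnipotent F E c N)) (𝓕 : Set (adelicUnipotent F E c N))
    (φ : (quasiSplit F E c N).Adelic → ℂ) (g : (quasiSplit F E c N).Adelic) : ℂ :=
  ((ν 𝓕).toReal⁻¹ : ℝ) • ∫ u in 𝓕, φ ((u : (quasiSplit F E c N).Adelic) * g) ∂ν

/-- Unfolding `borelConstantTerm`. [cite: Rogawski1990, §2.1] -/
theorem borelConstantTerm_def (ν : Measure (adelicUnipotent F E c N)) (𝓕 : Set (adelicUnipotent F E c N))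
    (φ : (quasiSplit F E c N).Adelic → ℂ) (g : (quasiSplit F E c N).Adelic) :
    borelConstantTerm ν 𝓕 φ g =
      ((ν 𝓕).toReal⁻¹ : ℝ) • ∫ u in 𝓕, φ ((u : (quasiSplit F E c N).Adelic) * g) ∂ν := rfl

/-- The Borel constant term of `0` is `0`. [cite: Rogawski1990, §2.1] -/
@[simp] theorem borelConstantTerm_zero (ν : Measure (adelicUnipotent F E c N))
    (𝓕 : Set (adelicUnipotent F E c N)) (g : (quasiSplit F E c N).Adelic) :
    borelConstantTerm ν 𝓕 (0 : (quasiSplit F E c N).Adelic → ℂ) g = 0 := by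
  simp [borelConstantTerm]

/-- The Borel constant term is additive in `φ` (on integrable data). [cite: Rogawski1990, §2.1] -/
theorem borelConstantTerm_add (ν : Measure (adelicUnipotent F E c N)) (𝓕 : Set (adelicUnipotent F E c N))
    {φ ψ : (quasiSplit F E c N).Adelic → ℂ} (g : (quasiSplit F E c N).Adelic)
    (hφ : IntegrableOn (fun u : adelicUnipotent F E c N => φ ((u : (quasiSplit F E c N).Adelic) * g)) 𝓕 ν)
    (hψ : IntegrableOn (fun u : adelicUnipotent F E c N => ψ ((u : (quasiSplit F E c N).Adelic) * g)) 𝓕 ν) :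
    borelConstantTerm ν 𝓕 (φ + ψ) g = borelConstantTerm ν 𝓕 φ g + borelConstantTerm ν 𝓕 ψ g := by
  simp only [borelConstantTerm, Pi.add_apply]
  rw [integral_add hφ hψ, smul_add]

/-- The Borel constant term is homogeneous in `φ`. [cite: Rogawski1990, §2.1] -/
theorem borelConstantTerm_smul (ν : Measure (adelicUnipotent F E c N)) (𝓕 : Set (adelicUnipotent F E c N))
    (a : ℂ) (φ : (quasiSplit F E c N).Adelic → ℂ) (g : (quasiSplit F E c N).Adelic) :
    borelConstantTerm ν 𝓕 (a • φ) g = a * borelConstantTerm ν 𝓕 φ g := by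
  simp only [borelConstantTerm, Pi.smul_apply, smul_eq_mul]
  rw [integral_const_mul, mul_smul_comm]

/-- The Borel constant term commutes with right translation: `(r(h)φ)_B(g) = φ_B(g h)`.
[cite: Rogawski1990, §2.1] -/
theorem borelConstantTerm_rightTranslation (ν : Measure (adelicUnipotent F E c N))
    (𝓕 : Set (adelicUnipotent F E c N)) (φ : (quasiSplit F E c N).Adelic → ℂ)
    (h g : (quasiSplit F E c N).Adelic) :
    borelConstantTerm ν 𝓕 (rightTranslation (quasiSplit F E c N) h φ) g =
      borelConstantTerm ν 𝓕 φ (g * h) := by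
  simp only [borelConstantTerm, rightTranslation_apply, mul_assoc]

end ConstantTerm

variable (F E c N) in
/-- **Cuspidality along the Borel subgroup**: for every σ-algebra making `N(𝔸_F)` a Borel space,
every Haar measure `ν` on it, every fundamental domain `𝓕` of `N(F)` and every `g`,
`u ↦ φ(u g)` is integrable on `𝓕` with integral `0` (`φ_B ≡ 0`). For `F`-rank one (`N = 2, 3`: the
Borel subgroup is the only proper standard parabolic of `U(J_N)`) this is the cusp condition of
Rogawski (1990), §2.1 («`φ_P = 0` for all `P`»); for `N ≥ 4` it is implied by, and weaker than,
cuspidality. [cite: Rogawski1990, §2.1] -/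
def BorelCuspCondition (φ : (quasiSplit F E c N).Adelic → ℂ) : Prop :=
  ∀ [MeasurableSpace (adelicUnipotent F E c N)] [BorelSpace (adelicUnipotent F E c N)]
    (ν : Measure (adelicUnipotent F E c N)) [ν.IsHaarMeasure]
    (𝓕 : Set (adelicUnipotent F E c N)),
    IsFundamentalDomain (rationalUnipotent F E c N) 𝓕 ν →
      ∀ g : (quasiSplit F E c N).Adelic,
        IntegrableOn (fun u : adelicUnipotent F E c N =>
          φ ((u : (quasiSplit F E c N).Adelic) * g)) 𝓕 ν ∧
        ∫ u in 𝓕, φ ((u : (quasiSplit F E c N).Adelic) * g) ∂ν = 0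

/-- The zero function is Borel-cuspidal. [cite: Rogawski1990, §2.1] -/
theorem BorelCuspCondition.zero : BorelCuspCondition F E c N 0 := by
  intro _ _ ν _ 𝓕 _ g
  exact ⟨integrableOn_zero, by simp⟩

/-- Borel-cuspidality is preserved under sums. [cite: Rogawski1990, §2.1] -/
theorem BorelCuspCondition.add {φ ψ : (quasiSplit F E c N).Adelic → ℂ}
    (hφ : BorelCuspCondition F E c N φ) (hψ : BorelCuspCondition F E c N ψ) :
    BorelCuspCondition F E c N (φ + ψ) := by
  intro _ _ ν _ 𝓕 h𝓕 g
  obtain ⟨hφi, hφ0⟩ := hφ ν 𝓕 h𝓕 g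
  obtain ⟨hψi, hψ0⟩ := hψ ν 𝓕 h𝓕 g
  refine ⟨hφi.add hψi, ?_⟩
  change ∫ u in 𝓕, φ _ + ψ _ ∂ν = 0
  rw [integral_add hφi hψi, hφ0, hψ0, add_zero]

/-- Borel-cuspidality is preserved under scalars. [cite: Rogawski1990, §2.1] -/
theorem BorelCuspCondition.smul {φ : (quasiSplit F E c N).Adelic → ℂ} (a : ℂ)
    (hφ : BorelCuspCondition F E c N φ) : BorelCuspCondition F E c N (a • φ) := by
  intro _ _ ν _ 𝓕 h𝓕 g
  obtain ⟨hφi, hφ0⟩ := hφ ν 𝓕 h𝓕 g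
  refine ⟨hφi.smul a, ?_⟩
  change ∫ u in 𝓕, a • φ _ ∂ν = 0
  rw [integral_smul, hφ0, smul_zero]

/-- Borel-cuspidality is invariant under right translation. [cite: Rogawski1990, §2.1] -/
theorem BorelCuspCondition.rightTranslation {φ : (quasiSplit F E c N).Adelic → ℂ}
    (hφ : BorelCuspCondition F E c N φ) (h : (quasiSplit F E c N).Adelic) :
    BorelCuspCondition F E c N (rightTranslation (quasiSplit F E c N) h φ) := by
  intro _ _ ν _ 𝓕 h𝓕 g
  simpa only [rightTranslation_apply, mul_assoc] using hφ ν 𝓕 h𝓕 (g * h)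

/-- **A Borel-cuspidal `φ` has vanishing Borel constant terms** for every Haar measure of
`N(𝔸_F)`, every fundamental domain of `N(F)` and every `g`. [cite: Rogawski1990, §2.1] -/
theorem BorelCuspCondition.borelConstantTerm_eq_zero
    [MeasurableSpace (adelicUnipotent F E c N)] [BorelSpace (adelicUnipotent F E c N)]
    {φ : (quasiSplit F E c N).Adelic → ℂ} (hφ : BorelCuspCondition F E c N φ)
    (ν : Measure (adelicUnipotent F E c N)) [ν.IsHaarMeasure]
    {𝓕 : Set (adelicUnipotent F E c N)} (h𝓕 : IsFundamentalDomain (rationalUnipotent F E c N) 𝓕 ν)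
    (g : (quasiSplit F E c N).Adelic) : borelConstantTerm ν 𝓕 φ g = 0 := by
  rw [borelConstantTerm_def, (hφ ν 𝓕 h𝓕 g).2, smul_zero]

/-! ## §2 Pseudo-Eisenstein sums, the tail of the constant term and the truncation `Λ^T` -/

section Truncation

variable (F E c N) in
/-- **`B(F)` inside `G(F)`**: the elements of the arithmetic subgroup `G(F) ≤ U(J_N)(𝔸_F)`
(`arithmeticSubgroup`, the diagonal image of `U(J_N)(F)`) that are upper triangular — the rational
Borel subgroup as a subgroup of `G(F)` (the index set `B(F)\G(F)` of Eisenstein and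
pseudo-Eisenstein sums; companion of `rationalBorel`, which is `B(F)` inside `B(𝔸_F)`).
[cite: Garrett2018, §2.10 (PDF p. 119)] -/
def arithmeticBorel : Subgroup (quasiSplit F E c N).arithmeticSubgroup :=
  (borelAdelic F E c N).subgroupOf (quasiSplit F E c N).arithmeticSubgroup

/-- Membership in `arithmeticBorel`: the element of `G(F)` lies in `B(𝔸_F)`. [cite: Garrett2018, §2.10 (PDF p. 119)] -/
theorem mem_arithmeticBorel_iff (γ : (quasiSplit F E c N).arithmeticSubgroup) :
    γ ∈ arithmeticBorel F E c N ↔ (γ : (quasiSplit F E c N).Adelic) ∈ borelAdelic F E c N := Iff.rfl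

/-- **The pseudo-Eisenstein sum** `Ψ_ψ(g) = Σ_{δ ∈ B(F)\G(F)} ψ(δ g)` of a function `ψ` on
`U(J_N)(𝔸_F)` (meant to be left-`B(F)`-invariant): a `finsum` over the right cosets `B(F)δ` of
`B(F)` in `G(F)` (`Quotient (QuotientGroup.rightRel B(F))`), each evaluated at the representative
`Quotient.out`; for left-`B(F)`-invariant `ψ` the terms do not depend on the representatives
(`pseudoEisenstein_term_eq`). Junk value `0` when infinitely many terms are non-zero (Garrett (2018),
§2.10: for the tail of a constant term the sum is locally finite). [cite: Garrett2018, §2.10 (PDF p. 119)] -/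
def pseudoEisenstein (ψ : (quasiSplit F E c N).Adelic → ℂ) (g : (quasiSplit F E c N).Adelic) : ℂ :=
  ∑ᶠ q : Quotient (QuotientGroup.rightRel (arithmeticBorel F E c N)),
    ψ (((q.out : (quasiSplit F E c N).arithmeticSubgroup) : (quasiSplit F E c N).Adelic) * g)

/-- Unfolding `pseudoEisenstein`. [cite: Garrett2018, §2.10 (PDF p. 119)] -/
theorem pseudoEisenstein_def (ψ : (quasiSplit F E c N).Adelic → ℂ) (g : (quasiSplit F E c N).Adelic) :
    pseudoEisenstein ψ g = ∑ᶠ q : Quotient (QuotientGroup.rightRel (arithmeticBorel F E c N)),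
      ψ (((q.out : (quasiSplit F E c N).arithmeticSubgroup) : (quasiSplit F E c N).Adelic) * g) := rfl

/-- `Ψ_0 = 0`. [cite: Garrett2018, §2.10 (PDF p. 119)] -/
@[simp] theorem pseudoEisenstein_zero (g : (quasiSplit F E c N).Adelic) :
    pseudoEisenstein (0 : (quasiSplit F E c N).Adelic → ℂ) g = 0 := by
  simp [pseudoEisenstein]

/-- `Ψ` is homogeneous: `Ψ_{a ψ} = a Ψ_ψ`. [cite: Garrett2018, §2.10 (PDF p. 119)] -/
theorem pseudoEisenstein_smul (a : ℂ) (ψ : (quasiSplit F E c N).Adelic → ℂ) (g : (quasiSplit F E c N).Adelic) :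
    pseudoEisenstein (a • ψ) g = a * pseudoEisenstein ψ g := by
  simp only [pseudoEisenstein, Pi.smul_apply, smul_eq_mul]
  exact (mul_finsum _ a).symm

/-- **Independence of representatives**: if `ψ` is left-invariant under `B(F)`, the term of `Ψ_ψ(g)`
at the coset of `γ ∈ G(F)` is `ψ(γ g)`. [cite: Garrett2018, §2.10 (PDF p. 119)] -/
theorem pseudoEisenstein_term_eq {ψ : (quasiSplit F E c N).Adelic → ℂ}
    (hψ : ∀ b ∈ arithmeticBorel F E c N, ∀ x : (quasiSplit F E c N).Adelic,
      ψ ((b : (quasiSplit F E c N).Adelic) * x) = ψ x)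
    (γ : (quasiSplit F E c N).arithmeticSubgroup) (g : (quasiSplit F E c N).Adelic) :
    ψ ((((Quotient.mk (QuotientGroup.rightRel (arithmeticBorel F E c N)) γ).out :
        (quasiSplit F E c N).arithmeticSubgroup) : (quasiSplit F E c N).Adelic) * g) =
      ψ ((γ : (quasiSplit F E c N).Adelic) * g) := by
  set δ := (Quotient.mk (QuotientGroup.rightRel (arithmeticBorel F E c N)) γ).out with hδ
  have hrel : γ * δ⁻¹ ∈ arithmeticBorel F E c N := by
    have h : @Setoid.r _ (QuotientGroup.rightRel (arithmeticBorel F E c N)) δ γ :=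
      Quotient.mk_out (s := QuotientGroup.rightRel (arithmeticBorel F E c N)) γ
    exact QuotientGroup.rightRel_apply.1 h
  have hδγ : (δ : (quasiSplit F E c N).Adelic) =
      ((γ * δ⁻¹)⁻¹ : (quasiSplit F E c N).arithmeticSubgroup) * (γ : (quasiSplit F E c N).Adelic) := by
    push_cast
    group
  rw [hδγ, mul_assoc, hψ _ (Subgroup.inv_mem _ hrel)]

variable [NeZero N] [MeasurableSpace (adelicUnipotent F E c N)]

/-- **The tail of the Borel constant term** above height `T`:
`c_B^T φ (x) = φ_B(x)` if `borelHeight x > T` and `0` otherwise (Garrett (2018), §2.10: `c_P^T f`;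
Rogawski (1990), §2.2: the factor `τ̂_P(H(x) − T)`). [cite: Garrett2018, §2.10 (PDF p. 119)] -/
def constantTermTail (ν : Measure (adelicUnipotent F E c N)) (𝓕 : Set (adelicUnipotent F E c N)) (T : ℝ≥0)
    (φ : (quasiSplit F E c N).Adelic → ℂ) : (quasiSplit F E c N).Adelic → ℂ :=
  Set.indicator {x | T < borelHeight x} (borelConstantTerm ν 𝓕 φ)

/-- The tail above the cut-off is the constant term. [cite: Garrett2018, §2.10 (PDF p. 119)] -/
theorem constantTermTail_of_lt {ν : Measure (adelicUnipotent F E c N)} {𝓕 : Set (adelicUnipotent F E c N)}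
    {T : ℝ≥0} (φ : (quasiSplit F E c N).Adelic → ℂ) {x : (quasiSplit F E c N).Adelic}
    (hx : T < borelHeight x) : constantTermTail ν 𝓕 T φ x = borelConstantTerm ν 𝓕 φ x :=
  Set.indicator_of_mem (s := {x | T < borelHeight x}) hx _

/-- The tail below the cut-off vanishes. [cite: Garrett2018, §2.10 (PDF p. 119)] -/
theorem constantTermTail_of_not_lt {ν : Measure (adelicUnipotent F E c N)}
    {𝓕 : Set (adelicUnipotent F E c N)} {T : ℝ≥0} (φ : (quasiSplit F E c N).Adelic → ℂ)
    {x : (quasiSplit F E c N).Adelic} (hx : ¬T < borelHeight x) : constantTermTail ν 𝓕 T φ x = 0 :=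
  Set.indicator_of_notMem (s := {x | T < borelHeight x}) hx _

/-- The tail of `0` is `0`. [cite: Garrett2018, §2.10 (PDF p. 119)] -/
@[simp] theorem constantTermTail_zero (ν : Measure (adelicUnipotent F E c N))
    (𝓕 : Set (adelicUnipotent F E c N)) (T : ℝ≥0) :
    constantTermTail ν 𝓕 T (0 : (quasiSplit F E c N).Adelic → ℂ) = 0 := by
  funext x
  by_cases hx : T < borelHeight x
  · rw [constantTermTail_of_lt _ hx, borelConstantTerm_zero, Pi.zero_apply]
  · rw [constantTermTail_of_not_lt _ hx, Pi.zero_apply]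

/-- The cut-off set is `N(𝔸_F)`-stable: `c_B^T φ (u x) = 1_{H(x) > T} φ_B(u x)`. [cite: Garrett2018, §2.10 (PDF p. 119)] -/
theorem constantTermTail_unipotent_mul (ν : Measure (adelicUnipotent F E c N))
    (𝓕 : Set (adelicUnipotent F E c N)) (T : ℝ≥0) (φ : (quasiSplit F E c N).Adelic → ℂ)
    {u : (quasiSplit F E c N).Adelic} (hu : u ∈ adelicUnipotent F E c N) (x : (quasiSplit F E c N).Adelic) :
    constantTermTail ν 𝓕 T φ (u * x) =
      Set.indicator {y | T < borelHeight y} (fun y => borelConstantTerm ν 𝓕 φ (u * y)) x := by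
  by_cases hx : T < borelHeight x
  · rw [Set.indicator_of_mem (s := {y | T < borelHeight y}) hx,
      constantTermTail_of_lt _ (by rwa [borelHeight_unipotent_mul hu])]
  · rw [Set.indicator_of_notMem (s := {y | T < borelHeight y}) hx,
      constantTermTail_of_not_lt _ (by rwa [borelHeight_unipotent_mul hu])]

/-- **Arthur's truncation operator in `F`-rank one**, realised along the Borel subgroup of
`U(J_N)`: `Λ^T φ = φ − Ψ(c_B^T φ)`, i.e.
`Λ^T φ(g) = φ(g) − Σ_{δ ∈ B(F)\G(F)} 1_{H(δg) > T} φ_B(δ g)` (Garrett (2018), §2.10: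
«a proper definition of the truncation operator is `Λ^T f = f − Ψ(c_P^T f)`»; Arthur, *A trace
formula for reductive groups II*, Compositio Math. 40 (1980), §1; Rogawski (1990), §2.2 uses the
same cut-off on kernels). For `N = 2, 3` (`F`-rank one: `B` is the only proper standard parabolic)
this is the full truncation operator; for `N ≥ 4` it is only the `P = B` term of Arthur's alternating
sum — recorded, not asserted. Parameters: a Haar measure `ν` of `N(𝔸_F)` and a fundamental domain
`𝓕` of `N(F)` realising `φ_B`. [cite: Garrett2018, §2.10 (PDF p. 119)] -/
def truncation (ν : Measure (adelicUnipotent F E c N)) (𝓕 : Set (adelicUnipotent F E c N)) (T : ℝ≥0)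
    (φ : (quasiSplit F E c N).Adelic → ℂ) (g : (quasiSplit F E c N).Adelic) : ℂ :=
  φ g - pseudoEisenstein (constantTermTail ν 𝓕 T φ) g

/-- Unfolding `truncation`. [cite: Garrett2018, §2.10 (PDF p. 119)] -/
theorem truncation_def (ν : Measure (adelicUnipotent F E c N)) (𝓕 : Set (adelicUnipotent F E c N)) (T : ℝ≥0)
    (φ : (quasiSplit F E c N).Adelic → ℂ) (g : (quasiSplit F E c N).Adelic) :
    truncation ν 𝓕 T φ g = φ g - pseudoEisenstein (constantTermTail ν 𝓕 T φ) g := rfl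

/-- `Λ^T 0 = 0`. [cite: Garrett2018, §2.10 (PDF p. 119)] -/
@[simp] theorem truncation_zero (ν : Measure (adelicUnipotent F E c N)) (𝓕 : Set (adelicUnipotent F E c N))
    (T : ℝ≥0) (g : (quasiSplit F E c N).Adelic) :
    truncation ν 𝓕 T (0 : (quasiSplit F E c N).Adelic → ℂ) g = 0 := by
  rw [truncation_def, constantTermTail_zero, pseudoEisenstein_zero, Pi.zero_apply, sub_zero]

/-- **`Λ^T` is the identity on Borel-cuspidal functions**: if all Borel constant terms of `φ` vanish
(`BorelCuspCondition`), then `Λ^T φ = φ` for every Haar measure `ν`, every fundamental domain `𝓕`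
and every `T` (Arthur: `Λ^T` fixes cusp forms). [cite: Garrett2018, §2.10 (PDF p. 119)] -/
theorem BorelCuspCondition.truncation_eq [BorelSpace (adelicUnipotent F E c N)]
    {φ : (quasiSplit F E c N).Adelic → ℂ} (hφ : BorelCuspCondition F E c N φ)
    (ν : Measure (adelicUnipotent F E c N)) [ν.IsHaarMeasure]
    {𝓕 : Set (adelicUnipotent F E c N)} (h𝓕 : IsFundamentalDomain (rationalUnipotent F E c N) 𝓕 ν)
    (T : ℝ≥0) (g : (quasiSplit F E c N).Adelic) : truncation ν 𝓕 T φ g = φ g := by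
  have htail : constantTermTail ν 𝓕 T φ = 0 := by
    funext x
    by_cases hx : T < borelHeight x
    · rw [constantTermTail_of_lt _ hx, hφ.borelConstantTerm_eq_zero ν h𝓕, Pi.zero_apply]
    · rw [constantTermTail_of_not_lt _ hx, Pi.zero_apply]
  rw [truncation_def, htail, pseudoEisenstein_zero, sub_zero]

end Truncation

end UnitaryGroup

end Literature.NumberTheory.Automorphic
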